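import Literature.MathematicalPhysics.QuantumFieldTheory.Balaban1983to89.B10Eq18SigmaSU2Haar

/-!
# `Balaban1983to89.B10Eq18SigmaSU2Window` — T. Bałaban, *Ultraviolet stability of three-dimensional lattice pure gauge
# field theories*, Commun. Math. Phys. **102** (1985) 255–275 [Balaban1985UV3], p. 260: the SU(2) example
# «σ(A) = 1/2π² (sin|A|/|A|)², σ₀ = σ(0)» ON THE CHART WINDOWS of (18) «χ(|A(b)| < g₀p²(g₀))» — the Haar mass of the
# window `{exp iA : |A| < s}` IN CLOSED FORM, `(s − sin s cos s)/π`, and the printed constant `σ₀ = 1/2π²` RECOVERED AS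
# THE WINDOW RATIO `dU′({exp iA : |A| < s}) / ∫_{|A|<s} (σ/σ₀)(A) d³A` at every radius `0 < s ≤ π`

statement-level skeleton of published theorems with citation tags; proofs where landed; nothing here is a claim
about the Yang–Mills mass gap

PDF held: `paper:balaban1985-cmp102-uv-stability-3d`; p. 260 [PDF 6] re-read by this seat from the x2 render
`pub-balaban/b2b-balaban-ref1/pages/1985-cmp102-uv-stability-3d/1985-cmp102-uv-stability-3d-p006-x2.png` (2026-08-22).

THE PRINTED TEXT.  p. 260 (verbatim): *"To write the integrals (13) in terms of the variables A′ we express the Haar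
measure dU′ as dU′ = σ(A′)dA′ = σ₀ σ/σ₀ (A′)dA′, σ₀ = σ(0), where dA′ is the Lebesque measure on 𝔤 … For example for
SU(2) we have σ(A) = 1/2π² (sin|A|/|A|)², where |A| = Σ_{a=1}^{3} (A^a)² ⟦sic⟧, and an element A of the Lie algebra is
represented as A = Σ_{a=1}^{3} σ_aA^a"*, and in (18) the characteristic functions *"χ = Π_{b∈Ω₁} χ({|A(b)| < g₀p²(g₀)})"*
restrict every bond variable to a WINDOW `{|A| < s}` of the chart.

WHAT IS REPRODUCED.  Mega-formalization `lit-balaban` (HOME `run/shared/lean/pub/lit-balaban/`), unit `lit-balaban-r07`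
gen 19.  SKELETON rows: narrative display E18 of `lit-balaban-r07/ROWS-B10.md` §2 (row of record **B10.Eq21** names the
σ-sentence in its depends-on cell).  State of the tree before this file: `B10Eq18SigmaSU2Haar` (r07 gen 18) proves the
sentence at MEASURE level for `SU(2)` — `∫ F dU = ∫_{|A|<π} F(exp iA) σ_{SU(2)}(|A|) d³A`
(`lintegral_haarProbability_eq_pauli`), the Haar mass of a chart window as an INTEGRAL
(`haarProbability_smallFieldWindow`: `dU({exp iA : |A| < ρ}) = ∫_{|A|<ρ} σ_{SU(2)}(|A|) d³A`, `ρ ≤ π`) and, with r10's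
`B13HaarSigmaJacobian`, `σ_{SU(2)}(|A|) = σ₀ · det jac(iA)` (`sigmaSU2_eq_sigma0_mul_det_jac`); `B10Eq22Rescaling` §8
(r07 gen 17) proves `∫_{|A|<π} σ_{SU(2)} = 1` by radial integration.  Meanwhile the cell landed [Helgason2000] Ch. I §1
Thm. 1.14 (13) at measure level for EVERY closed `G ≤ U(N)` (p24 `HaarExpChartClosedSubgroup` p322107; p28
`HaarLocalChart`/`HaarExponentialChart…` p320990/p321835/p322253): there the chart windows are OPERATOR-NORM balls
`{X ∈ 𝐠 : ‖X‖ < r}` and the constant `σ₀` is EXISTENTIAL (p24) or the WINDOW RATIO `μ(V_s)/∫_{‖X‖<s} |det jac X| dX`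
(p28).  THIS FILE supplies, on this seat's `SU(2)` carrier and BY NAME from the files above, exactly the two facts that
evaluate those general statements at print's example:
* §1 **`‖iΣσ_aA^a‖_op = |A|`** (`norm_su2Coord`; the `L²`-operator norm of `M₂(ℂ)`, the norm of the cell's `LogChart`s):
  the operator-norm chart balls ARE print's Euclidean balls `{|A| < s}` in the coordinates `A^a` (`su2Coord_mem_ball_iff`;
  `A ↦ iΣσ_aA^a` is an isometry, `norm_su2Coord_sub`); proof: the Pauli ↔ quaternion dictionary of `B10Eq18SigmaSU2Haar`
  §1 and the tree's `T4QuatExpLog.norm_quatMatrix`, `T4HaarSU2ExpChart.norm_imQuat`.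
* §2 **THE HAAR MASS OF A WINDOW IN CLOSED FORM**: `∫_{|A|<s} σ_{SU(2)}(|A|) d³A = (s − sin s cos s)/π` for every `s ≥ 0`
  (`integral_sigmaSU2_ball_eq`; radial integration as in `B10Eq22Rescaling` §8, Mathlib `integral_sin_sq`), hence
  `dU({exp iA : |A| < s}) = (s − sin s cos s)/π = (2s − sin 2s)/2π` for `0 ≤ s ≤ π` (`haarProbability_window_eq`,
  `haarProbability_window_eq_two_mul`); `s = π` returns total mass `1` (`haarProbability_window_pi`); the mass is
  positive for `s > 0`, `< 1` for `s < π`, monotone in `s` (`haarProbability_window_pos`/`_lt_one`/`_mono`).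
* §3 the same for print's RATIO `σ/σ₀ = (sin|A|/|A|)²` (= `det jac(iA)` by `B10Eq18SigmaSU2Haar.sigmaSU2_eq_sigma0_mul_det_jac`,
  = r10's `det_jac_su2_real`): `∫_{|A|<s} (σ/σ₀)(A) d³A = 2π(s − sin s cos s)` (`integral_sigmaRatio_ball_eq`,
  `lintegral_sigmaRatio_ball_eq`, `integral_sinc_sq_ball_eq`).
* §4 **`σ₀ = σ(0) = 1/2π²` AS THE WINDOW RATIO**: for every `0 < s ≤ π`,
  `σ₀ = dU({exp iA : |A| < s}) / ∫_{|A|<s} (σ/σ₀)(A) d³A` (`sigma0_eq_window_ratio`, `ofReal_sigma0_eq_window_ratio` in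
  `ℝ≥0∞` — the shape of the normalising constant of the general measure-level Thm. 1.14 (13)), the window-restricted
  density formula `∫_{exp(i{|A|<s})} F dU = ∫_{|A|<s} F(exp iA) σ(|A|) d³A = σ₀ ∫_{|A|<s} F(exp iA)(σ/σ₀)(A) d³A`
  (`setLIntegral_haarProbability_window`, `setLIntegral_haarProbability_window_ratio`), and UNIQUENESS of the window
  constant: any `c ∈ [0,∞]` with `∫_{window} F dU = c ∫_{|A|<s} F(exp iA)(σ/σ₀) d³A` for all measurable `F ≥ 0` equals `σ₀`
  (`window_const_unique`; `window_const_unique_sigma`: with `σ` itself as the density the constant is `1`) — so an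
  existential `σ₀` (p24's form) is pinned to print's value at `G = SU(2)` once the charts are identified (§1); the
  general window formula `setLIntegral_haarProbability_image` (any Borel `W ⊆ {|A| < π}`).

HONEST SCOPE.  (i) Nothing of `B10Eq18SigmaSU2Haar`, `B10Eq22Rescaling`, `T4HaarSU2ExpChart`, `T4QuatExpLog` is re-proved;
the only computation is the radial integral `∫₀^s sin²`.  (ii) `SU(2)` only, on this seat's carrier
(`Matrix.specialUnitaryGroup (Fin 2) ℂ`, `haarProbability`, coordinates `EuclideanSpace ℝ (Fin 3)`); the by-name
instantiation of p24's / p28's general theorems at `SU(2)` is NOT done here (their Lie-algebra carriers are subtypes of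
`M₂(ℂ)`; §1 is the norm identification such a knit needs).  (iii) No claim about (13)/(18) beyond the one-bond window
sentence.  0 definitions, 0 new named facts.
-/

noncomputable section

open MeasureTheory MeasureTheory.Measure Set Metric NormedSpace
open scoped ENNReal

namespace Literature.MathematicalPhysics.QuantumFieldTheory.Balaban1983to89.B10Eq18SigmaSU2Window

open Literature.MathematicalPhysics.QuantumLattice (quatMatrix)
open Literature.MathematicalPhysics.QuantumFieldTheory (haarProbability)
open T4HaarSU2ExpChart T4QuatExpLog B10Eq18SigmaSU2 B10Eq22Rescaling B10Eq18SigmaSU2Haar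

/-! ## §1  `‖iΣσ_aA^a‖_op = |A|`: the operator-norm chart balls are print's Euclidean balls -/

section OpNorm

open scoped Matrix.Norms.L2Operator

/-- **`‖iΣ_aσ_aA^a‖ = |A|`**: the `L²`-operator norm (the `C⋆`-norm of `M₂(ℂ)`, the norm of the cell's exponential
charts) of print's Lie-algebra element `A = Σσ_aA^a` (times `i`) is the Euclidean length `|A| = (Σ(A^a)²)^{1/2}` of its
Pauli coordinates — through the dictionary `iΣσ_aA^a = quatMatrix(ι(rev A))` and `‖quatMatrix q‖ = ‖q‖`.
[cite: Balaban1985UV3, p. 260] -/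
theorem norm_su2Coord (A : EuclideanSpace ℝ (Fin 3)) : ‖su2Coord A‖ = ‖A‖ := by
  rw [← quatMatrix_imQuat_rev, norm_quatMatrix, norm_imQuat, norm_rev]

/-- `A ↦ iΣσ_aA^a` is additive: `iΣσ_a(A − B)^a = iΣσ_aA^a − iΣσ_aB^a`. [cite: Balaban1985UV3, p. 260] -/
theorem su2Coord_sub (x y : Fin 3 → ℝ) : su2Coord (x - y) = su2Coord x - su2Coord y := by
  simp only [su2Coord_eq_sum, Pi.sub_apply, Complex.ofReal_sub, sub_mul, sub_smul, Finset.sum_sub_distrib]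

/-- **The Pauli coordinates are isometric**: `‖iΣσ_aA^a − iΣσ_aB^a‖_op = |A − B|`. [cite: Balaban1985UV3, p. 260] -/
theorem norm_su2Coord_sub (A B : EuclideanSpace ℝ (Fin 3)) : ‖su2Coord A - su2Coord B‖ = ‖A - B‖ := by
  rw [← norm_su2Coord (A - B), WithLp.ofLp_sub, su2Coord_sub]

/-- **The operator-norm window is print's window**: `‖iΣσ_aA^a‖ < s ↔ |A| < s`. [cite: Balaban1985UV3, (18) p. 260] -/
theorem su2Coord_mem_ball_iff {A : EuclideanSpace ℝ (Fin 3)} {s : ℝ} :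
    su2Coord A ∈ ball (0 : Matrix (Fin 2) (Fin 2) ℂ) s ↔ A ∈ ball (0 : EuclideanSpace ℝ (Fin 3)) s := by
  rw [mem_ball_zero_iff, mem_ball_zero_iff, norm_su2Coord]

/-- The same for closed balls: `‖iΣσ_aA^a‖ ≤ s ↔ |A| ≤ s`. [cite: Balaban1985UV3, (18) p. 260] -/
theorem su2Coord_mem_closedBall_iff {A : EuclideanSpace ℝ (Fin 3)} {s : ℝ} :
    su2Coord A ∈ closedBall (0 : Matrix (Fin 2) (Fin 2) ℂ) s ↔ A ∈ closedBall (0 : EuclideanSpace ℝ (Fin 3)) s := by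
  rw [mem_closedBall_zero_iff, mem_closedBall_zero_iff, norm_su2Coord]

end OpNorm

/-! ## §2  The Haar mass of the window `{exp iA : |A| < s}` in closed form: `(s − sin s cos s)/π` -/

section Mass

/-- The unit ball of `ℝ³` has volume `4π/3` (Mathlib `EuclideanSpace.volume_ball_fin_three`), as a real number. [folklore] -/
private theorem volume_real_unitBall_three :
    (volume : Measure (EuclideanSpace ℝ (Fin 3))).real (ball 0 1) = 4 * Real.pi / 3 := by
  rw [measureReal_def, EuclideanSpace.volume_ball_fin_three]
  rw [ENNReal.toReal_mul, ← ENNReal.ofReal_pow zero_le_one, one_pow, ENNReal.toReal_ofReal zero_le_one,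
    ENNReal.toReal_ofReal (by positivity)]
  ring

/-- On `y > 0` the radial integrand `y² σ_{SU(2)}(y) 1_{y<s}` is `1_{y<s} · (1/2π²) sin² y`. [cite: Balaban1985UV3, p. 260] -/
private theorem radial_integrand_eq {s y : ℝ} (hy : 0 < y) :
    y ^ 2 * (Iio s).indicator sigmaSU2 y = (Iio s).indicator (fun t => 1 / (2 * Real.pi ^ 2) * Real.sin t ^ 2) y := by
  by_cases h : y < s
  · rw [indicator_of_mem (show y ∈ Iio s from h), indicator_of_mem (show y ∈ Iio s from h), sigmaSU2, if_neg hy.ne']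
    field_simp
  · rw [indicator_of_notMem (show y ∉ Iio s from h), indicator_of_notMem (show y ∉ Iio s from h), mul_zero]

/-- The radial integral at radius `s ≥ 0`: `∫_{y>0} y² σ_{SU(2)}(y) 1_{y<s} dy = (1/2π²)∫₀^s sin² = (s − sin s cos s)/(4π²)`.
[cite: Balaban1985UV3, p. 260] -/
theorem radial_integral_sigmaSU2_eq {s : ℝ} (hs : 0 ≤ s) :
    ∫ y in Ioi (0 : ℝ), y ^ 2 * (Iio s).indicator sigmaSU2 y = (s - Real.sin s * Real.cos s) / (4 * Real.pi ^ 2) := by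
  rw [setIntegral_congr_fun measurableSet_Ioi (fun y hy => radial_integrand_eq hy)]
  rw [setIntegral_indicator measurableSet_Iio, show Ioi (0 : ℝ) ∩ Iio s = Ioo 0 s from rfl]
  rw [← integral_Ioc_eq_integral_Ioo, ← intervalIntegral.integral_of_le hs, intervalIntegral.integral_const_mul,
    integral_sin_sq, Real.sin_zero, zero_mul, zero_sub, sub_zero]
  field_simp
  ring

/-- **`∫_{|A|<s} σ_{SU(2)}(|A|) d³A = (s − sin s cos s)/π` for every `s ≥ 0`** — print's density integrated over the
ball of radius `s` of `𝔰𝔲(2) ≅ ℝ³` (radial integration: `3 · (4π/3) · (s − sin s cos s)/(4π²)`).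
[cite: Balaban1985UV3, p. 260] -/
theorem integral_indicator_sigmaSU2_ball_eq {s : ℝ} (hs : 0 ≤ s) :
    ∫ A : EuclideanSpace ℝ (Fin 3), (ball (0 : EuclideanSpace ℝ (Fin 3)) s).indicator (fun A => sigmaSU2 ‖A‖) A =
      (s - Real.sin s * Real.cos s) / Real.pi := by
  have h1 : (fun A : EuclideanSpace ℝ (Fin 3) => (ball (0 : EuclideanSpace ℝ (Fin 3)) s).indicator
      (fun A => sigmaSU2 ‖A‖) A) = fun A => (Iio s).indicator sigmaSU2 ‖A‖ := by
    funext A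
    by_cases h : ‖A‖ < s
    · rw [indicator_of_mem (mem_ball_zero_iff.mpr h), indicator_of_mem (show ‖A‖ ∈ Iio s from h)]
    · rw [indicator_of_notMem (fun h' => h (mem_ball_zero_iff.mp h')), indicator_of_notMem (show ‖A‖ ∉ Iio s from h)]
  rw [h1, MeasureTheory.integral_fun_norm_addHaar volume ((Iio s).indicator sigmaSU2), finrank_euclideanSpace_fin,
    volume_real_unitBall_three]
  simp only [smul_eq_mul, nsmul_eq_mul]
  norm_num
  rw [radial_integral_sigmaSU2_eq hs]
  field_simp

/-- The same as a set integral: `∫_{|A|<s} σ_{SU(2)}(|A|) d³A = (s − sin s cos s)/π`, `s ≥ 0`. [cite: Balaban1985UV3, p. 260] -/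
theorem integral_sigmaSU2_ball_eq {s : ℝ} (hs : 0 ≤ s) :
    ∫ A in ball (0 : EuclideanSpace ℝ (Fin 3)) s, sigmaSU2 ‖A‖ = (s - Real.sin s * Real.cos s) / Real.pi := by
  rw [← integral_indicator measurableSet_ball, integral_indicator_sigmaSU2_ball_eq hs]

/-- `sin s cos s ≤ s` for `s ≥ 0` (`sin 2s ≤ 2s`). [folklore] -/
private theorem sin_mul_cos_le {s : ℝ} (hs : 0 ≤ s) : Real.sin s * Real.cos s ≤ s := by
  have h := Real.sin_le (show 0 ≤ 2 * s by linarith)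
  rw [Real.sin_two_mul] at h
  linarith

/-- `sin s cos s < s` for `s > 0` (`sin 2s < 2s`). [folklore] -/
private theorem sin_mul_cos_lt {s : ℝ} (hs : 0 < s) : Real.sin s * Real.cos s < s := by
  have h := Real.sin_lt (show 0 < 2 * s by linarith)
  rw [Real.sin_two_mul] at h
  linarith

/-- The closed form `(s − sin s cos s)/π` is nonnegative for `s ≥ 0`. [folklore] -/
private theorem window_mass_nonneg {s : ℝ} (hs : 0 ≤ s) : 0 ≤ (s - Real.sin s * Real.cos s) / Real.pi :=
  div_nonneg (sub_nonneg.2 (sin_mul_cos_le hs)) Real.pi_pos.le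

/-- The closed form `(s − sin s cos s)/π` is positive for `s > 0`. [folklore] -/
private theorem window_mass_pos {s : ℝ} (hs : 0 < s) : 0 < (s - Real.sin s * Real.cos s) / Real.pi :=
  div_pos (sub_pos.2 (sin_mul_cos_lt hs)) Real.pi_pos

/-- **THE HAAR MASS OF THE CHART WINDOW IN CLOSED FORM: `dU({exp iA : |A| < s}) = (s − sin s cos s)/π`** for
`0 ≤ s ≤ π` (normalised Haar measure of `SU(2)`; the window `χ({|A(b)| < g₀p²(g₀)})` of (18) is such a set, one bond).
[cite: Balaban1985UV3, (18) p. 260] -/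
theorem haarProbability_window_eq {s : ℝ} (hs0 : 0 ≤ s) (hs : s ≤ Real.pi) :
    haarProbability (Matrix.specialUnitaryGroup (Fin 2) ℂ) (expPauli '' ball (0 : EuclideanSpace ℝ (Fin 3)) s) =
      ENNReal.ofReal ((s - Real.sin s * Real.cos s) / Real.pi) := by
  rw [haarProbability_smallFieldWindow hs, integral_sigmaSU2_ball_eq hs0]

/-- Real-valued form: `dU({exp iA : |A| < s}) = (s − sin s cos s)/π`, `0 ≤ s ≤ π`. [cite: Balaban1985UV3, (18) p. 260] -/
theorem haarProbability_real_window_eq {s : ℝ} (hs0 : 0 ≤ s) (hs : s ≤ Real.pi) :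
    (haarProbability (Matrix.specialUnitaryGroup (Fin 2) ℂ)).real (expPauli '' ball (0 : EuclideanSpace ℝ (Fin 3)) s) =
      (s - Real.sin s * Real.cos s) / Real.pi := by
  rw [measureReal_def, haarProbability_window_eq hs0 hs, ENNReal.toReal_ofReal (window_mass_nonneg hs0)]

/-- Double-angle form: `dU({exp iA : |A| < s}) = (2s − sin 2s)/2π`, `0 ≤ s ≤ π`. [cite: Balaban1985UV3, (18) p. 260] -/
theorem haarProbability_window_eq_two_mul {s : ℝ} (hs0 : 0 ≤ s) (hs : s ≤ Real.pi) :
    haarProbability (Matrix.specialUnitaryGroup (Fin 2) ℂ) (expPauli '' ball (0 : EuclideanSpace ℝ (Fin 3)) s) =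
      ENNReal.ofReal ((2 * s - Real.sin (2 * s)) / (2 * Real.pi)) := by
  rw [haarProbability_window_eq hs0 hs, Real.sin_two_mul]
  congr 1
  field_simp

/-- Consistency at `s = π`: the full injectivity ball carries mass `(π − sin π cos π)/π = 1` (the tree's
`B10Eq18SigmaSU2Haar.sigmaMeasure_univ` / `B10Eq22Rescaling.integral_sigmaSU2_ball` recovered from the closed form).
[cite: Balaban1985UV3, p. 260] -/
theorem haarProbability_window_pi :
    haarProbability (Matrix.specialUnitaryGroup (Fin 2) ℂ) (expPauli '' ball (0 : EuclideanSpace ℝ (Fin 3)) Real.pi) = 1 := by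
  rw [haarProbability_window_eq Real.pi_pos.le le_rfl, Real.sin_pi, zero_mul, sub_zero, div_self Real.pi_pos.ne',
    ENNReal.ofReal_one]

/-- **Every chart window has positive Haar mass**: `0 < dU({exp iA : |A| < s})` for `0 < s ≤ π`.
[cite: Balaban1985UV3, (18) p. 260] -/
theorem haarProbability_window_pos {s : ℝ} (hs0 : 0 < s) (hs : s ≤ Real.pi) :
    0 < haarProbability (Matrix.specialUnitaryGroup (Fin 2) ℂ) (expPauli '' ball (0 : EuclideanSpace ℝ (Fin 3)) s) := by
  rw [haarProbability_window_eq hs0.le hs]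
  exact ENNReal.ofReal_pos.2 (window_mass_pos hs0)

/-- … and it is `< 1` exactly when `s < π`: for `0 ≤ s < π`, `dU({exp iA : |A| < s}) < 1` (the complement window has
positive mass). [cite: Balaban1985UV3, (18) p. 260] -/
theorem haarProbability_window_lt_one {s : ℝ} (hs0 : 0 ≤ s) (hs : s < Real.pi) :
    haarProbability (Matrix.specialUnitaryGroup (Fin 2) ℂ) (expPauli '' ball (0 : EuclideanSpace ℝ (Fin 3)) s) < 1 := by
  rw [haarProbability_window_eq hs0 hs.le, ← ENNReal.ofReal_one]
  refine (ENNReal.ofReal_lt_ofReal_iff_of_nonneg (window_mass_nonneg hs0)).2 ?_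
  rw [div_lt_one Real.pi_pos]
  have h2 := Real.sin_lt (show 0 < 2 * Real.pi - 2 * s by linarith)
  rw [Real.sin_sub, Real.sin_two_pi, Real.cos_two_pi, zero_mul, one_mul, zero_sub, Real.sin_two_mul] at h2
  linarith

/-- Monotonicity of the window mass — what (18) uses is monotonicity in the radius: for `s ≤ t`, `dU({exp iA : |A| < s}) ≤ dU({exp iA : |A| < t})`.
[cite: Balaban1985UV3, (18) p. 260] -/
theorem haarProbability_window_mono {s t : ℝ} (hst : s ≤ t) :
    haarProbability (Matrix.specialUnitaryGroup (Fin 2) ℂ) (expPauli '' ball (0 : EuclideanSpace ℝ (Fin 3)) s) ≤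
      haarProbability (Matrix.specialUnitaryGroup (Fin 2) ℂ) (expPauli '' ball (0 : EuclideanSpace ℝ (Fin 3)) t) :=
  measure_mono (image_mono (ball_subset_ball hst))

end Mass

/-! ## §3  The same for the ratio `σ/σ₀ = (sin|A|/|A|)²` (= `det jac(iA)`): `∫_{|A|<s} (σ/σ₀)(A) d³A = 2π(s − sin s cos s)` -/

section Ratio

/-- `σ_{SU(2)}(|A|)/σ₀ = sinc²|A|` (`sinc r = sin r/r`, `sinc 0 = 1`), `σ₀ = σ_{SU(2)}(0) = 1/2π²`. [cite: Balaban1985UV3, p. 260] -/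
theorem sigmaSU2_div_sigma0_eq_sinc_sq (A : EuclideanSpace ℝ (Fin 3)) :
    sigmaSU2 ‖A‖ / sigmaSU2 0 = Real.sinc ‖A‖ ^ 2 := by
  rw [sigmaSU2_norm_eq_expWeight, expWeight, sigmaSU2_zero, one_div]
  have h : (2 * Real.pi ^ 2 : ℝ)⁻¹ ≠ 0 := by positivity
  field_simp

/-- `0 ≤ σ/σ₀ ≤ 1`. [cite: Balaban1985UV3, p. 260] -/
theorem sigmaSU2_div_sigma0_nonneg (A : EuclideanSpace ℝ (Fin 3)) : 0 ≤ sigmaSU2 ‖A‖ / sigmaSU2 0 := by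
  rw [sigmaSU2_div_sigma0_eq_sinc_sq]
  positivity

/-- `σ/σ₀ ≤ 1` (`|sinc| ≤ 1`). [cite: Balaban1985UV3, p. 260] -/
theorem sigmaSU2_div_sigma0_le_one (A : EuclideanSpace ℝ (Fin 3)) : sigmaSU2 ‖A‖ / sigmaSU2 0 ≤ 1 := by
  rw [sigmaSU2_div_sigma0_eq_sinc_sq, sq_le_one_iff_abs_le_one]
  exact Real.abs_sinc_le_one ‖A‖

/-- `A ↦ (σ/σ₀)(A)` is measurable. [cite: Balaban1985UV3, p. 260] -/
theorem measurable_sigmaSU2_div_sigma0 :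
    Measurable fun A : EuclideanSpace ℝ (Fin 3) => sigmaSU2 ‖A‖ / sigmaSU2 0 :=
  measurable_sigmaSU2_norm.div_const _

/-- `A ↦ (σ/σ₀)(A)` is integrable on every ball (bounded by `1` on a set of finite Lebesgue measure). [cite: Balaban1985UV3, p. 260] -/
theorem integrableOn_sigmaSU2_div_sigma0_ball (s : ℝ) :
    IntegrableOn (fun A : EuclideanSpace ℝ (Fin 3) => sigmaSU2 ‖A‖ / sigmaSU2 0) (ball 0 s) volume := by
  refine Measure.integrableOn_of_bounded (M := 1) measure_ball_lt_top.ne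
    measurable_sigmaSU2_div_sigma0.aestronglyMeasurable (Filter.Eventually.of_forall fun A => ?_)
  rw [Real.norm_of_nonneg (sigmaSU2_div_sigma0_nonneg A)]
  exact sigmaSU2_div_sigma0_le_one A

/-- **`∫_{|A|<s} (σ/σ₀)(A) d³A = 2π(s − sin s cos s)`** for every `s ≥ 0` — the Lebesgue integral of print's ratio
`σ/σ₀ = (sin|A|/|A|)²` (which is `det jac(iA)`, the Jacobian determinant of the exponential chart:
`B10Eq18SigmaSU2Haar.sigmaSU2_eq_sigma0_mul_det_jac`, r10's `B13HaarSigmaJacobian.det_jac_su2_real`) over the window.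
[cite: Balaban1985UV3, p. 260] -/
theorem integral_sigmaRatio_ball_eq {s : ℝ} (hs : 0 ≤ s) :
    ∫ A in ball (0 : EuclideanSpace ℝ (Fin 3)) s, sigmaSU2 ‖A‖ / sigmaSU2 0 =
      2 * Real.pi * (s - Real.sin s * Real.cos s) := by
  rw [integral_div, integral_sigmaSU2_ball_eq hs, sigmaSU2_zero]
  field_simp

/-- The same with `sinc²|A|` as the integrand. [cite: Balaban1985UV3, p. 260] -/
theorem integral_sinc_sq_ball_eq {s : ℝ} (hs : 0 ≤ s) :
    ∫ A in ball (0 : EuclideanSpace ℝ (Fin 3)) s, Real.sinc ‖A‖ ^ 2 = 2 * Real.pi * (s - Real.sin s * Real.cos s) := by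
  rw [← integral_sigmaRatio_ball_eq hs]
  exact setIntegral_congr_fun measurableSet_ball fun A _ => (sigmaSU2_div_sigma0_eq_sinc_sq A).symm

/-- `ℝ≥0∞` form: `∫⁻_{|A|<s} (σ/σ₀)(A) d³A = 2π(s − sin s cos s)`, `s ≥ 0`. [cite: Balaban1985UV3, p. 260] -/
theorem lintegral_sigmaRatio_ball_eq {s : ℝ} (hs : 0 ≤ s) :
    ∫⁻ A in ball (0 : EuclideanSpace ℝ (Fin 3)) s, ENNReal.ofReal (sigmaSU2 ‖A‖ / sigmaSU2 0) =
      ENNReal.ofReal (2 * Real.pi * (s - Real.sin s * Real.cos s)) := by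
  rw [← ofReal_integral_eq_lintegral_ofReal (integrableOn_sigmaSU2_div_sigma0_ball s)
    (Filter.Eventually.of_forall fun A => sigmaSU2_div_sigma0_nonneg A), integral_sigmaRatio_ball_eq hs]

/-- Positivity of the closed form `2π(s − sin s cos s)` for `s > 0`. [folklore] -/
private theorem integral_sigmaRatio_ball_pos {s : ℝ} (hs : 0 < s) : 0 < 2 * Real.pi * (s - Real.sin s * Real.cos s) :=
  mul_pos (by positivity) (sub_pos.2 (sin_mul_cos_lt hs))

end Ratio

/-! ## §4  `σ₀ = 1/2π²` as the window ratio `dU(window)/∫_{window} σ/σ₀`, the window density formula, uniqueness of the constant -/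

section Sigma0

/-- **THE WINDOW-RESTRICTED DENSITY FORMULA: `∫_{exp(iW)} F dU = ∫_W F(exp iA) σ_{SU(2)}(|A|) d³A`** for every measurable
`W ⊆ {|A| < π}` and measurable `F ≥ 0` (from `B10Eq18SigmaSU2Haar.haarProbability_restrict_image_expPauli`).
[cite: Balaban1985UV3, (18) p. 260] -/
theorem setLIntegral_haarProbability_image {W : Set (EuclideanSpace ℝ (Fin 3))} (hW : MeasurableSet W)
    (hWπ : W ⊆ ball (0 : EuclideanSpace ℝ (Fin 3)) Real.pi)
    (F : Matrix.specialUnitaryGroup (Fin 2) ℂ → ℝ≥0∞) (hF : Measurable F) :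
    ∫⁻ U in expPauli '' W, F U ∂(haarProbability (Matrix.specialUnitaryGroup (Fin 2) ℂ)) =
      ∫⁻ A in W, F (expPauli A) * ENNReal.ofReal (sigmaSU2 ‖A‖) := by
  have hσ : sigmaMeasure.restrict W =
      (volume.restrict W).withDensity fun A : EuclideanSpace ℝ (Fin 3) => ENNReal.ofReal (sigmaSU2 ‖A‖) := by
    rw [sigmaMeasure, restrict_withDensity hW, Measure.restrict_restrict hW, inter_eq_left.2 hWπ]
  rw [haarProbability_restrict_image_expPauli hW hWπ, lintegral_map hF measurable_expPauli, hσ,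
    lintegral_withDensity_eq_lintegral_mul_non_measurable _ measurable_sigmaSU2_norm.ennreal_ofReal
      (Filter.Eventually.of_forall fun x => ENNReal.ofReal_lt_top) _]
  refine lintegral_congr fun A => ?_
  simp only [Pi.mul_apply, mul_comm]

/-- **On the window of radius `s ≤ π`: `∫_{{exp iA : |A|<s}} F dU = ∫_{|A|<s} F(exp iA) σ_{SU(2)}(|A|) d³A`.**
[cite: Balaban1985UV3, (18) p. 260] -/
theorem setLIntegral_haarProbability_window {s : ℝ} (hs : s ≤ Real.pi)
    (F : Matrix.specialUnitaryGroup (Fin 2) ℂ → ℝ≥0∞) (hF : Measurable F) :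
    ∫⁻ U in expPauli '' ball (0 : EuclideanSpace ℝ (Fin 3)) s, F U ∂(haarProbability (Matrix.specialUnitaryGroup (Fin 2) ℂ)) =
      ∫⁻ A in ball (0 : EuclideanSpace ℝ (Fin 3)) s, F (expPauli A) * ENNReal.ofReal (sigmaSU2 ‖A‖) :=
  setLIntegral_haarProbability_image measurableSet_ball (ball_subset_ball hs) F hF

/-- The window formula with the constant pulled out: `∫_{window} F dU = σ₀ ∫_{|A|<s} F(exp iA) (σ/σ₀)(A) d³A`, `σ₀ = 1/2π²`
— the shape `σ₀ · ∫ F(exp X) det jac(X) dX` of [Helgason2000] Thm. 1.14 (13). [cite: Balaban1985UV3, (18) p. 260]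
[cite: Helgason2000, Ch. I §1 Thm. 1.14 (13) p. 96] -/
theorem setLIntegral_haarProbability_window_ratio {s : ℝ} (hs : s ≤ Real.pi)
    (F : Matrix.specialUnitaryGroup (Fin 2) ℂ → ℝ≥0∞) (hF : Measurable F) :
    ∫⁻ U in expPauli '' ball (0 : EuclideanSpace ℝ (Fin 3)) s, F U ∂(haarProbability (Matrix.specialUnitaryGroup (Fin 2) ℂ)) =
      ENNReal.ofReal (sigmaSU2 0) *
        ∫⁻ A in ball (0 : EuclideanSpace ℝ (Fin 3)) s, F (expPauli A) * ENNReal.ofReal (sigmaSU2 ‖A‖ / sigmaSU2 0) := by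
  rw [setLIntegral_haarProbability_window hs F hF, ← lintegral_const_mul' _ _ ENNReal.ofReal_ne_top]
  refine lintegral_congr fun A => ?_
  have h0 : 0 < sigmaSU2 0 := by rw [sigmaSU2_zero]; positivity
  rw [mul_left_comm, ← ENNReal.ofReal_mul h0.le, mul_div_cancel₀ _ h0.ne']

/-- **`σ₀ = σ(0) = 1/2π²` AS THE WINDOW RATIO**: for every `0 < s ≤ π`,
`σ₀ = dU({exp iA : |A| < s}) / ∫_{|A|<s} (σ/σ₀)(A) d³A` (`= [(s − sin s cos s)/π] / [2π(s − sin s cos s)]`) — the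
normalising constant of the measure-level Thm. 1.14 (13), «Haar mass of the window over the Jacobian integral of the
window», EVALUATED at print's example and independent of the radius. [cite: Balaban1985UV3, p. 260]
[cite: Helgason2000, Ch. I §1 Thm. 1.14 (13) p. 96] -/
theorem sigma0_eq_window_ratio {s : ℝ} (hs0 : 0 < s) (hs : s ≤ Real.pi) :
    sigmaSU2 0 =
      (haarProbability (Matrix.specialUnitaryGroup (Fin 2) ℂ)).real (expPauli '' ball (0 : EuclideanSpace ℝ (Fin 3)) s) /
        ∫ A in ball (0 : EuclideanSpace ℝ (Fin 3)) s, sigmaSU2 ‖A‖ / sigmaSU2 0 := by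
  rw [haarProbability_real_window_eq hs0.le hs, integral_sigmaRatio_ball_eq hs0.le, sigmaSU2_zero]
  have h1 : 0 < s - Real.sin s * Real.cos s := sub_pos.2 (sin_mul_cos_lt hs0)
  field_simp

/-- `ℝ≥0∞` form of the window ratio: `σ₀ = dU(V_s) / ∫⁻_{|A|<s} (σ/σ₀) d³A`, `V_s = {exp iA : |A| < s}`, `0 < s ≤ π`.
[cite: Balaban1985UV3, p. 260] [cite: Helgason2000, Ch. I §1 Thm. 1.14 (13) p. 96] -/
theorem ofReal_sigma0_eq_window_ratio {s : ℝ} (hs0 : 0 < s) (hs : s ≤ Real.pi) :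
    ENNReal.ofReal (sigmaSU2 0) =
      haarProbability (Matrix.specialUnitaryGroup (Fin 2) ℂ) (expPauli '' ball (0 : EuclideanSpace ℝ (Fin 3)) s) /
        ∫⁻ A in ball (0 : EuclideanSpace ℝ (Fin 3)) s, ENNReal.ofReal (sigmaSU2 ‖A‖ / sigmaSU2 0) := by
  rw [lintegral_sigmaRatio_ball_eq hs0.le, haarProbability_window_eq hs0.le hs,
    ← ENNReal.ofReal_div_of_pos (integral_sigmaRatio_ball_pos hs0), sigmaSU2_zero]
  congr 1
  have h1 : 0 < s - Real.sin s * Real.cos s := sub_pos.2 (sin_mul_cos_lt hs0)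
  field_simp

/-- **UNIQUENESS OF THE WINDOW CONSTANT**: if `c ∈ [0,∞]` satisfies `∫_{V_s} F dU = c · ∫_{|A|<s} F(exp iA)(σ/σ₀)(A) d³A`
for every measurable `F ≥ 0` (`V_s = {exp iA : |A| < s}`, `0 < s ≤ π`), then `c = σ₀ = 1/2π²` — an EXISTENTIAL
normalising constant in the measure-level Thm. 1.14 (13) is forced to print's `σ₀ = σ(0)` at `G = SU(2)`.
[cite: Balaban1985UV3, p. 260] [cite: Helgason2000, Ch. I §1 Thm. 1.14 (13) p. 96] -/
theorem window_const_unique {s : ℝ} (hs0 : 0 < s) (hs : s ≤ Real.pi) {c : ℝ≥0∞}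
    (hc : ∀ F : Matrix.specialUnitaryGroup (Fin 2) ℂ → ℝ≥0∞, Measurable F →
      ∫⁻ U in expPauli '' ball (0 : EuclideanSpace ℝ (Fin 3)) s, F U ∂(haarProbability (Matrix.specialUnitaryGroup (Fin 2) ℂ)) =
        c * ∫⁻ A in ball (0 : EuclideanSpace ℝ (Fin 3)) s, F (expPauli A) * ENNReal.ofReal (sigmaSU2 ‖A‖ / sigmaSU2 0)) :
    c = ENNReal.ofReal (sigmaSU2 0) := by
  have h1 := hc (fun _ => 1) measurable_const
  simp only [one_mul, setLIntegral_one] at h1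
  have hne0 : ∫⁻ A in ball (0 : EuclideanSpace ℝ (Fin 3)) s, ENNReal.ofReal (sigmaSU2 ‖A‖ / sigmaSU2 0) ≠ 0 := by
    rw [lintegral_sigmaRatio_ball_eq hs0.le]
    exact (ENNReal.ofReal_pos.2 (integral_sigmaRatio_ball_pos hs0)).ne'
  have hneT : ∫⁻ A in ball (0 : EuclideanSpace ℝ (Fin 3)) s, ENNReal.ofReal (sigmaSU2 ‖A‖ / sigmaSU2 0) ≠ ⊤ := by
    rw [lintegral_sigmaRatio_ball_eq hs0.le]
    exact ENNReal.ofReal_ne_top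
  rw [ofReal_sigma0_eq_window_ratio hs0 hs, h1, ENNReal.mul_div_cancel_right hne0 hneT]

/-- The same uniqueness with the density written as `σ` (not the ratio): a constant `c` with
`∫_{V_s} F dU = c · ∫_{|A|<s} F(exp iA) σ_{SU(2)}(|A|) d³A` for all measurable `F ≥ 0` equals `1` (print's `dU′ = σ(A′)dA′`
carries no hidden constant on this seat's normalisation: `σ₀` is INSIDE `σ`). [cite: Balaban1985UV3, p. 260] -/
theorem window_const_unique_sigma {s : ℝ} (hs0 : 0 < s) (hs : s ≤ Real.pi) {c : ℝ≥0∞}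
    (hc : ∀ F : Matrix.specialUnitaryGroup (Fin 2) ℂ → ℝ≥0∞, Measurable F →
      ∫⁻ U in expPauli '' ball (0 : EuclideanSpace ℝ (Fin 3)) s, F U ∂(haarProbability (Matrix.specialUnitaryGroup (Fin 2) ℂ)) =
        c * ∫⁻ A in ball (0 : EuclideanSpace ℝ (Fin 3)) s, F (expPauli A) * ENNReal.ofReal (sigmaSU2 ‖A‖)) :
    c = 1 := by
  have h1 := hc (fun _ => 1) measurable_const
  simp only [one_mul, setLIntegral_one] at h1
  have h2 := setLIntegral_haarProbability_window hs (fun _ => 1) measurable_const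
  simp only [one_mul, setLIntegral_one] at h2
  have hne0 : ∫⁻ A in ball (0 : EuclideanSpace ℝ (Fin 3)) s, ENNReal.ofReal (sigmaSU2 ‖A‖) ≠ 0 := by
    rw [← h2, haarProbability_window_eq hs0.le hs]
    exact (ENNReal.ofReal_pos.2 (window_mass_pos hs0)).ne'
  have hneT : ∫⁻ A in ball (0 : EuclideanSpace ℝ (Fin 3)) s, ENNReal.ofReal (sigmaSU2 ‖A‖) ≠ ⊤ := by
    rw [← h2]
    exact measure_ne_top _ _
  have h3 : c * ∫⁻ A in ball (0 : EuclideanSpace ℝ (Fin 3)) s, ENNReal.ofReal (sigmaSU2 ‖A‖) =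
      1 * ∫⁻ A in ball (0 : EuclideanSpace ℝ (Fin 3)) s, ENNReal.ofReal (sigmaSU2 ‖A‖) := by rw [← h1, h2, one_mul]
  exact (ENNReal.mul_left_inj hne0 hneT).1 h3

end Sigma0

end Literature.MathematicalPhysics.QuantumFieldTheory.Balaban1983to89.B10Eq18SigmaSU2Window

end
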